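import Summits.CriticalPhenomena.PercolationContinuityZ3.Theorems.PercNearOneGluingNoHeavyLowerTailSuperTerminalQuarticFace

/-!
# The square-root law `(SQ)` implies the super-terminal quartic law `V4` (event level, every finite weighted graph)

Support file for crux `stmt-CriticalPhenomena-4575` (`NoHeavyLowerTail`), lead seat `prim-nh-lead-4575` gen 128
(`--supports stmt-CriticalPhenomena-4575`; memo `run/shared/lean/prim/prim-sahi/FROM-prim-nh-lead-4575-g128-V4-FIBRE-SQ.md` §1).
No definitions, no sorries, standard axioms.

Bond percolation `μ = prodBernoulli w` on a finite vertex type, vertices `s a b c` (no distinctness needed);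
`F = (s↔a) ∩ (s↔b)ᶜ`, `c∤T = (c↔s)ᶜ ∩ (c↔a)ᶜ ∩ (c↔b)ᶜ`, `Q = μ(F ∩ c∤T)`, `A = μ(F ∩ (c↔s)ᶜ ∩ (c↔a)ᶜ)`, `B = μ(F ∩ (c↔b)ᶜ)`,
`C = μ(c∤T)`.  The lane's target (prim-l12-p1 gen 24–26) is the SUPER-TERMINAL QUARTIC LAW `V4 : Q⁴ ≤ A²·B²·C`
(⟹ `P3_{1/2}` ⟹ TCB ⟹ TT-CHORD for `E₃`, all in the tree).  This file records the elementary reduction found by the lead (gen 128):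

* `quartic_of_sqrtLaw_alg` — pure algebra: `0 ≤ q ≤ A ≤ f`, `f + q = A + B`, `0 ≤ C`, `q² ≤ f²·C` ⟹ `q⁴ ≤ A²·B²·C`
  (because `A·B − f·q = (f − A)·(f − B) = (f − A)·(A − q) ≥ 0`);
* `superTerminalQuartic_of_sqrtLaw` — **`(SQ) ⟹ V4`** on every finite weighted graph, where
  **`(SQ) : μ(F ∩ c∤T)² ≤ μ(F)² · μ(c∤T)`**, i.e. `P(c∤T | s∼a, s≁b) ≤ √P(c∤T)`, equivalently `P(F | c∤T)·P(c∤T | F) ≤ P(F)`;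
  the identity `μ(F) + Q = A + B` is `SuperTerminalQuarticFace.real_F_add` (under `F` the port cannot meet both the block and `b`);
* `p3_half_of_sqrtLaw` — hence `(SQ) ⟹ P3_{1/2}` (`μ(F)·μ(c↔T) ≤ 2·μ(F ∩ c↔T)`), by `p3_half_of_superTerminalQuartic`.

`(SQ)` has the same face as `V4` (`P3_{1/2}`) at the isolated corner and is numerically unrefuted (lead gen 128, kit campaigns);
it is OPEN.  Nothing here claims `(SQ)`; the file only makes the implication available to the kernel.
-/

namespace Summit.CriticalPhenomena.PercolationContinuityZ3.Theorems.SuperTerminalQuarticOfSqrtLaw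

open MeasureTheory Set
open Literature.Probability.Percolation Literature.Probability.LatticeModels
open scoped Classical

/-- Pure algebra behind `(SQ) ⟹ V4`: if `0 ≤ q ≤ A ≤ f`, `f + q = A + B`, `0 ≤ C` and `q² ≤ f²·C`,
then `q⁴ ≤ A²·B²·C`.  Key step: `A·B − f·q = (f − A)·(f − B) = (f − A)·(A − q) ≥ 0`. [this work] -/
theorem quartic_of_sqrtLaw_alg {q A B f C : ℝ} (hq : 0 ≤ q) (hqA : q ≤ A) (hAf : A ≤ f)
    (hie : f + q = A + B) (hC : 0 ≤ C) (hsq : q ^ 2 ≤ f ^ 2 * C) : q ^ 4 ≤ A ^ 2 * B ^ 2 * C := by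
  have hBf : f - B = A - q := by linarith
  have hfq_le : f * q ≤ A * B := by nlinarith [mul_nonneg (sub_nonneg.mpr hAf) (sub_nonneg.mpr hqA)]
  have hfq_nn : 0 ≤ f * q := mul_nonneg (le_trans (le_trans hq hqA) hAf) hq
  have hsq' : (f * q) ^ 2 ≤ (A * B) ^ 2 := by
    exact pow_le_pow_left₀ hfq_nn hfq_le 2
  have h1 : q ^ 4 ≤ (f * q) ^ 2 * C := by
    have : q ^ 4 = q ^ 2 * q ^ 2 := by ring
    rw [this]
    have hq2 : 0 ≤ q ^ 2 := by positivity
    calc q ^ 2 * q ^ 2 ≤ (f ^ 2 * C) * q ^ 2 := by exact mul_le_mul_of_nonneg_right hsq hq2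
      _ = (f * q) ^ 2 * C := by ring
  calc q ^ 4 ≤ (f * q) ^ 2 * C := h1
    _ ≤ (A * B) ^ 2 * C := by exact mul_le_mul_of_nonneg_right hsq' hC
    _ = A ^ 2 * B ^ 2 * C := by ring

variable {V : Type*} [Fintype V]

/-- **`(SQ) ⟹ V4` on every finite weighted graph.**  If `μ(F ∩ c∤T)² ≤ μ(F)²·μ(c∤T)` for `μ = prodBernoulli w`,
`F = (s↔a) ∩ (s↔b)ᶜ`, `c∤T = (c↔s)ᶜ ∩ (c↔a)ᶜ ∩ (c↔b)ᶜ`, then the super-terminal quartic law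
`μ(F ∩ c∤T)⁴ ≤ μ(F ∩ (c↔s)ᶜ ∩ (c↔a)ᶜ)² · μ(F ∩ (c↔b)ᶜ)² · μ(c∤T)` holds. [this work] -/
theorem superTerminalQuartic_of_sqrtLaw (w : Sym2 V → unitInterval) (s a b c : V)
    (hSQ : (prodBernoulli w).real (openConn s a ∩ (openConn s b)ᶜ ∩ ((openConn c s)ᶜ ∩ (openConn c a)ᶜ ∩ (openConn c b)ᶜ) : Set (BondConfig V)) ^ 2 ≤
      (prodBernoulli w).real (openConn s a ∩ (openConn s b)ᶜ : Set (BondConfig V)) ^ 2 *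
      (prodBernoulli w).real ((openConn c s)ᶜ ∩ (openConn c a)ᶜ ∩ (openConn c b)ᶜ : Set (BondConfig V))) :
    (prodBernoulli w).real (openConn s a ∩ (openConn s b)ᶜ ∩ ((openConn c s)ᶜ ∩ (openConn c a)ᶜ ∩ (openConn c b)ᶜ) : Set (BondConfig V)) ^ 4 ≤
      (prodBernoulli w).real (openConn s a ∩ (openConn s b)ᶜ ∩ ((openConn c s)ᶜ ∩ (openConn c a)ᶜ) : Set (BondConfig V)) ^ 2 *
      (prodBernoulli w).real (openConn s a ∩ (openConn s b)ᶜ ∩ (openConn c b)ᶜ : Set (BondConfig V)) ^ 2 *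
      (prodBernoulli w).real ((openConn c s)ᶜ ∩ (openConn c a)ᶜ ∩ (openConn c b)ᶜ : Set (BondConfig V)) := by
  set μ := prodBernoulli w with hμ
  set F : Set (BondConfig V) := openConn s a ∩ (openConn s b)ᶜ with hF
  set I : Set (BondConfig V) := (openConn c s)ᶜ ∩ (openConn c a)ᶜ ∩ (openConn c b)ᶜ with hI
  set IA : Set (BondConfig V) := (openConn c s)ᶜ ∩ (openConn c a)ᶜ with hIA
  set IB : Set (BondConfig V) := (openConn c b)ᶜ with hIB
  have hie : μ.real F + μ.real (F ∩ I) = μ.real (F ∩ IA) + μ.real (F ∩ IB) :=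
    SuperTerminalQuarticFace.real_F_add w s a b c
  have hq : 0 ≤ μ.real (F ∩ I) := measureReal_nonneg
  have hC : 0 ≤ μ.real I := measureReal_nonneg
  have hqA : μ.real (F ∩ I) ≤ μ.real (F ∩ IA) := by
    apply measureReal_mono _
    intro ω hω
    simp only [hI, hIA, mem_inter_iff] at hω ⊢
    exact ⟨hω.1, hω.2.1⟩
  have hAf : μ.real (F ∩ IA) ≤ μ.real F := measureReal_mono inter_subset_left
  exact quartic_of_sqrtLaw_alg hq hqA hAf hie hC hSQ

/-- **`(SQ) ⟹ P3_{1/2}`**: under the square-root law, conditioning on the pattern `sa|b` costs the increasing event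
`c ↔ {s,a,b}` at most a factor `½`: `μ(F)·μ(c↔T) ≤ 2·μ(F ∩ c↔T)`. [this work] -/
theorem p3_half_of_sqrtLaw (w : Sym2 V → unitInterval) (s a b c : V)
    (hSQ : (prodBernoulli w).real (openConn s a ∩ (openConn s b)ᶜ ∩ ((openConn c s)ᶜ ∩ (openConn c a)ᶜ ∩ (openConn c b)ᶜ) : Set (BondConfig V)) ^ 2 ≤
      (prodBernoulli w).real (openConn s a ∩ (openConn s b)ᶜ : Set (BondConfig V)) ^ 2 *
      (prodBernoulli w).real ((openConn c s)ᶜ ∩ (openConn c a)ᶜ ∩ (openConn c b)ᶜ : Set (BondConfig V))) :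
    (prodBernoulli w).real (openConn s a ∩ (openConn s b)ᶜ : Set (BondConfig V)) *
        (prodBernoulli w).real ((openConn c s)ᶜ ∩ (openConn c a)ᶜ ∩ (openConn c b)ᶜ : Set (BondConfig V))ᶜ ≤
      2 * (prodBernoulli w).real (openConn s a ∩ (openConn s b)ᶜ ∩ ((openConn c s)ᶜ ∩ (openConn c a)ᶜ ∩ (openConn c b)ᶜ)ᶜ : Set (BondConfig V)) :=
  SuperTerminalQuarticFace.p3_half_of_superTerminalQuartic w s a b c (superTerminalQuartic_of_sqrtLaw w s a b c hSQ)

end Summit.CriticalPhenomena.PercolationContinuityZ3.Theorems.SuperTerminalQuarticOfSqrtLaw
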